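import Literature.NumberTheory.EllipticCurves.SqrtTwoTwistFrobeniusNorm
import Literature.NumberTheory.EllipticCurves.SqrtTwoTwistBrewer
import Literature.NumberTheory.EllipticCurves.IsogenyTwoTorsionProofs
import Mathlib.GroupTheory.Perm.Cycle.Type
import Mathlib.GroupTheory.SpecificGroups.Cyclic
import HarnessLib

/-!
# Brewer's character sum at `p ≡ 1 (mod 8)` via the `2`-Sylow subgroup of `B₁(𝔽_p)`: an elementary proof of half the sign law

Topic `Literature/NumberTheory/EllipticCurves`, namespace `Literature.NumberTheory.EllipticCurves.SqrtTwoTwist` (sequel to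
`SqrtTwoTwistFrobeniusNorm`, `SqrtTwoTwistBrewer`).  THEOREMS ONLY.

Brewer's theorem (Trans. AMS 99 (1961); Leonard–Williams 1975): for `p ≡ 1, 3 (mod 8)`, `p = c² + 2d²`, `c ≡ (−1)^{⌊p/8⌋+1} (mod 4)`:
`Σ_x ((x+2)(x²−2)/p) = 2c`.  The printed proofs are cyclotomic.  By `SqrtTwoTwistFrobeniusNorm` (Deuring, unsigned, a theorem of the tree)
`a_p(B₁) = 2a` with `p = a² + 2b²` for `B₁ : y² = x³ + 4x² + 2x`, so Brewer's evaluation at `p` is EQUIVALENT to the congruence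
`a_p(B₁) ≡ 2·(−1/p)·(−1)^{⌊p/8⌋} (mod 8)` (`brewer_at_of_frobeniusTrace_mod_eight`), i.e. to `#B₁(𝔽_p) mod 8`.  For `p ≡ 1 (mod 8)`
(`√2 ∈ 𝔽_p`, full rational `2`-torsion `O, (0,0), (−2 ± √2, 0)`) this is a statement about the `2`-Sylow subgroup, which we settle
by elementary means:

* §1 for `η ∈ 𝔽_p` with `η⁴ = −1` put `s = η + η⁻¹` (`s² = 2`): `2 + s = η⁻¹(η + 1)²` is a square iff `η` is, iff `16 ∣ p − 1`;
* §2 doubling on `B₁` (the tree's `addX_self_eq/_mul`: `x(2Q)·(2y)² = (x² − 2)²`): if `2Q = (e, 0)` then `e` is a square (`e ≠ 0`), resp.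
  `2 ± s` is a square (`e = 0`); so for `p ≡ 9 (mod 16)` NO `2`-torsion point is divisible by `2` in `B₁(𝔽_p)`, whence (doubling map,
  Cauchy) `8 ∤ #B₁(𝔽_p)` (`not_eight_dvd_natCard`);
* §3 for `p ≡ 1 (mod 16)`: `ζ` of order `16`, `η = ζ²`, `w = ζ + ζ⁻¹` (`w² = 2 + s`): `P = (s, 2w) ∈ B₁(𝔽_p)` has `2P = (0,0)`, order `4`,
  and `(−2+s, 0) ∉ ⟨P⟩`, whence (Lagrange in `B₁(𝔽_p)/⟨P⟩`) `8 ∣ #B₁(𝔽_p)` (`eight_dvd_natCard`);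
* §4 ★ `brewer_characterSum_of_mod_eight_eq_one` — **Brewer's evaluation for every prime `p ≡ 1 (mod 8)`**, and the reduction
  `Brewer1961_characterSum_of_three : Brewer1961_characterSum_three → Brewer1961_characterSum` of the tree's named fact to its
  `p ≡ 3 (mod 8)` clause (`Brewer1961_characterSum_three`, the remaining named leaf: there the `2`-Sylow of `B₁(𝔽_p)` is `ℤ/2` and the
  sign is invisible to it; Leonard–Williams treat it with Eisenstein sums over `𝔽_{p²}`).

## References
* B. W. Brewer, *On certain character sums*, Trans. AMS 99 (1961), 241–245. [Brewer1961]
* P. A. Leonard, K. S. Williams, *Jacobi sums and a theorem of Brewer*, Rocky Mountain J. Math. 5 (1975), Theorem p. 301. [LeonardWilliams1975]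
* A. R. Rajwade, *Arithmetic on curves with complex multiplication by √−2*, Proc. Cambridge Philos. Soc. 64 (1968). [Rajwade1968]
* J. H. Silverman, *The Arithmetic of Elliptic Curves*, 2nd ed. (2009), III.2.3 (duplication formula). [SilvermanAEC2009]

## Mathlib / tree search
Tree: `SqrtTwoTwist.exists_sq_add_two_sq_and_frobeniusTrace_eq` (`SqrtTwoTwistFrobeniusNorm`), `brewerSum`, `Brewer1961_characterSum`,
`sum_quadraticChar_B_eq_brewerSum` (`SqrtTwoTwistBrewer`), `natCard_point_eq_card_add_one_add_sum` (`SqrtTwoTwistPointCount`),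
`WeierstrassCurve.{addX_self_mul, addX_self_eq, addY_self_eq, slope_self_eq, negY_of_isTwoTorsionNF, equation_iff_of_isTwoTorsionNF}`
(`IsogenyTwoTorsionProofs`).  Mathlib: `Affine.Point.add_self_of_Y_ne/_of_Y_eq`, `IsCyclic.card_orderOf_eq_totient`, `ZMod.card_units`,
`ZMod.orderOf_dvd_card_sub_one`, `orderOf_eq_prime_pow`, `exists_prime_addOrderOf_dvd_card`, `QuotientAddGroup.quotientKerEquivRange`,
`AddSubgroup.card_eq_card_quotient_mul_card_addSubgroup`, `Nat.card_zmultiples`.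
-/

noncomputable section

open scoped Classical

namespace Literature.NumberTheory.EllipticCurves

namespace SqrtTwoTwist

open _root_.WeierstrassCurve

/-! ### §1 Eighth roots of unity: `(η + η⁻¹)² = 2` and the square class of `2 + η + η⁻¹` -/

section Residues

variable {F : Type*} [Field F]

/-- `s = η + η⁻¹` satisfies `s² = 2` when `η⁴ = −1`. [cite: IrelandRosen1990, Ch. 6 §3 (Gauss sum for (2/p))] -/
theorem sq_eta_add_inv {η : F} (hη : η ^ 4 = -1) : (η + η⁻¹) ^ 2 = 2 := by
  have hη0 : η ≠ 0 := by rintro rfl; norm_num at hη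
  have h1 : η * η⁻¹ = 1 := mul_inv_cancel₀ hη0
  have hinv : (η⁻¹) ^ 2 = -(η ^ 2) := by
    have h2 : η ^ 2 * (-(η ^ 2)) = 1 := by linear_combination -hη
    have : (η ^ 2)⁻¹ = -(η ^ 2) := inv_eq_of_mul_eq_one_right h2
    rw [inv_pow, this]
  calc (η + η⁻¹) ^ 2 = η ^ 2 + 2 * (η * η⁻¹) + (η⁻¹) ^ 2 := by ring
    _ = 2 := by rw [h1, hinv]; ring

/-- `2 + (η + η⁻¹) = η⁻¹ (η + 1)²`. [cite: IrelandRosen1990, Ch. 6 §3] -/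
theorem two_add_eta_add_inv {η : F} (hη0 : η ≠ 0) : 2 + (η + η⁻¹) = η⁻¹ * (η + 1) ^ 2 := by
  field_simp; ring

/-- For `η⁴ = −1` (odd characteristic): **`2 + η + η⁻¹` is a square iff `η` is a square.** [cite: IrelandRosen1990, Ch. 6 §3] -/
theorem isSquare_two_add_iff {η : F} (h2 : (2 : F) ≠ 0) (hη : η ^ 4 = -1) : IsSquare (2 + (η + η⁻¹)) ↔ IsSquare η := by
  have hη0 : η ≠ 0 := by rintro rfl; norm_num at hη
  have hη1 : η + 1 ≠ 0 := by
    intro h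
    have : η = -1 := by linear_combination h
    rw [this] at hη; norm_num at hη
    exact h2 (by linear_combination hη)
  rw [two_add_eta_add_inv hη0]
  constructor
  · rintro ⟨r, hr⟩
    have hr0 : r ≠ 0 := by
      rintro rfl
      rw [mul_zero] at hr
      exact (mul_ne_zero (inv_ne_zero hη0) (pow_ne_zero 2 hη1)) hr
    refine ⟨(η + 1) / r, ?_⟩
    rw [div_mul_div_comm, ← hr]
    field_simp
  · rintro ⟨r, hr⟩
    have hr0 : r ≠ 0 := by rintro rfl; exact hη0 (by simpa using hr)
    refine ⟨(η + 1) / r, ?_⟩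
    rw [div_mul_div_comm, ← hr]
    field_simp

/-- In `ℤ/p` with `p ≡ 9 (mod 16)`: an `η` with `η⁴ = −1` is NOT a square (a square root would have order `16 ∤ p − 1`).
[cite: IrelandRosen1990, Ch. 4 §1 (cyclicity of (ℤ/p)^×)] -/
theorem not_isSquare_of_pow_four_eq_neg_one {p : ℕ} [Fact p.Prime] (hp : p % 16 = 9) {η : ZMod p} (hη : η ^ 4 = -1) :
    ¬ IsSquare η := by
  rintro ⟨v, hv⟩
  have hchar : ringChar (ZMod p) ≠ 2 := by rw [ZMod.ringChar_zmod_n]; omega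
  have h2 : (2 : ZMod p) ≠ 0 := Ring.two_ne_zero hchar
  have hp1 : (1 : ZMod p) ≠ -1 := fun h ↦ h2 (by linear_combination h)
  have hv0 : v ≠ 0 := by
    rintro rfl
    rw [mul_zero] at hv
    rw [hv] at hη
    norm_num at hη
  have h8 : ¬ v ^ 2 ^ 3 = 1 := by
    intro h
    have : η ^ 4 = 1 := by rw [hv, show (v * v) ^ 4 = v ^ 2 ^ 3 by ring, h]
    rw [hη] at this
    exact hp1 this.symm
  have h16 : v ^ 2 ^ (3 + 1) = 1 := by
    have : v ^ 2 ^ (3 + 1) = (η ^ 4) ^ 2 := by rw [hv]; ring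
    rw [this, hη]; norm_num
  have hord : orderOf v = 16 := by
    have := orderOf_eq_prime_pow h8 h16
    norm_num at this; exact this
  have hdvd := ZMod.orderOf_dvd_card_sub_one hv0
  rw [hord] at hdvd
  have hp1' : 1 ≤ p := (Fact.out : p.Prime).one_le
  omega

/-- In `ℤ/p`: an element of order `d ∣ p − 1` exists ((ℤ/p)^× is cyclic); used for `d = 8, 16`. [cite: IrelandRosen1990, Ch. 4 §1, Theorem 1] -/
theorem exists_orderOf_eq {p : ℕ} [Fact p.Prime] {d : ℕ} (hd : d ∣ p - 1) (hd0 : 0 < d) :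
    ∃ u : (ZMod p)ˣ, orderOf u = d := by
  have hcard : d ∣ Fintype.card (ZMod p)ˣ := by rw [ZMod.card_units]; exact hd
  have h := IsCyclic.card_orderOf_eq_totient hcard
  have hpos : 0 < (Finset.univ.filter fun a : (ZMod p)ˣ ↦ orderOf a = d).card := by
    rw [h]; exact Nat.totient_pos.mpr hd0
  obtain ⟨u, hu⟩ := Finset.card_pos.mp hpos
  exact ⟨u, (Finset.mem_filter.mp hu).2⟩

/-- From a unit of order `8`: `η ∈ ℤ/p` with `η⁴ = −1`. [cite: IrelandRosen1990, Ch. 4 §1] -/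
theorem exists_pow_four_eq_neg_one {p : ℕ} [Fact p.Prime] (hp : p % 8 = 1) : ∃ η : ZMod p, η ^ 4 = -1 := by
  have hp1 : 1 ≤ p := (Fact.out : p.Prime).one_le
  obtain ⟨u, hu⟩ := exists_orderOf_eq (p := p) (d := 8) (by omega) (by norm_num)
  refine ⟨(u : ZMod p), ?_⟩
  have h8 : (u : ZMod p) ^ 8 = 1 := by rw [← Units.val_pow_eq_pow_val, ← hu, pow_orderOf_eq_one, Units.val_one]
  have h4 : (u : ZMod p) ^ 4 ≠ 1 := by
    intro h
    have : orderOf u ∣ 4 := orderOf_dvd_of_pow_eq_one (Units.ext (by rw [Units.val_pow_eq_pow_val, h, Units.val_one]))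
    rw [hu] at this; norm_num at this
  have hsq : ((u : ZMod p) ^ 4) * ((u : ZMod p) ^ 4) = 1 := by rw [← pow_add]; exact h8
  rcases mul_self_eq_one_iff.mp hsq with h | h
  · exact absurd h h4
  · exact h

/-- From a unit of order `16`: `ζ ∈ ℤ/p` with `ζ⁸ = −1`. [cite: IrelandRosen1990, Ch. 4 §1] -/
theorem exists_pow_eight_eq_neg_one {p : ℕ} [Fact p.Prime] (hp : p % 16 = 1) : ∃ ζ : ZMod p, ζ ^ 8 = -1 := by
  have hp1 : 1 ≤ p := (Fact.out : p.Prime).one_le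
  obtain ⟨u, hu⟩ := exists_orderOf_eq (p := p) (d := 16) (by omega) (by norm_num)
  refine ⟨(u : ZMod p), ?_⟩
  have h16 : (u : ZMod p) ^ 16 = 1 := by rw [← Units.val_pow_eq_pow_val, ← hu, pow_orderOf_eq_one, Units.val_one]
  have h8 : (u : ZMod p) ^ 8 ≠ 1 := by
    intro h
    have : orderOf u ∣ 8 := orderOf_dvd_of_pow_eq_one (Units.ext (by rw [Units.val_pow_eq_pow_val, h, Units.val_one]))
    rw [hu] at this; norm_num at this
  have hsq : ((u : ZMod p) ^ 8) * ((u : ZMod p) ^ 8) = 1 := by rw [← pow_add]; exact h16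
  rcases mul_self_eq_one_iff.mp hsq with h | h
  · exact absurd h h8
  · exact h

end Residues

/-! ### §2 Doubling on `B₁ : y² = x³ + 4x² + 2x` over `ℤ/p` -/

section Doubling

variable {p : ℕ} [Fact p.Prime]

/-- The points of order dividing `2` on `B₁(𝔽_p)`: `P + P = 0` forces `P = O` or `P = (x, 0)` with `x(x² + 4x + 2) = 0`.
[cite: SilvermanAEC2009, III.2.3] -/
theorem eq_of_add_self_eq_zero (hp2 : p ≠ 2) {P : (⟨0, 4, 0, 2, 0⟩ : WeierstrassCurve (ZMod p)).toAffine.Point}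
    (hP : P + P = 0) : P = 0 ∨ ∃ (x : ZMod p) (h : (⟨0, 4, 0, 2, 0⟩ : WeierstrassCurve (ZMod p)).toAffine.Nonsingular x 0),
      P = .some x 0 h ∧ x * (x ^ 2 + 4 * x + 2) = 0 := by
  rcases P with _ | ⟨x, y, hxy⟩
  · exact Or.inl rfl
  · right
    have h2 : (2 : ZMod p) ≠ 0 := Ring.two_ne_zero (by rw [ZMod.ringChar_zmod_n]; exact hp2)
    by_cases hy : y = (⟨0, 4, 0, 2, 0⟩ : WeierstrassCurve (ZMod p)).toAffine.negY x y
    · have hy0 : y = 0 := by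
        rw [negY_of_isTwoTorsionNF] at hy
        have : (2 : ZMod p) * y = 0 := by linear_combination hy
        exact (mul_eq_zero.mp this).resolve_left h2
      subst hy0
      refine ⟨x, hxy, rfl, ?_⟩
      have := (equation_iff_of_isTwoTorsionNF _ x 0).mp hxy.1
      simp only at this
      linear_combination -this
    · exfalso
      rw [Affine.Point.add_self_of_Y_ne hy] at hP
      exact Affine.Point.some_ne_zero _ hP

/-- **Halving a `2`-torsion point costs a square.** If `Q + Q = (e, 0)` on `B₁(𝔽_p)` (`p` odd) with `Q = (x, y)`, then `y ≠ 0`,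
`e · (2y)² = (x² − 2)²`; hence `e` is a square, and if `e = 0` then `x² = 2` and `(y/2)² = 2 + x`.
[cite: SilvermanAEC2009, III.2.3 (duplication formula)] -/
theorem isSquare_of_add_self_eq (hp2 : p ≠ 2) {Q : (⟨0, 4, 0, 2, 0⟩ : WeierstrassCurve (ZMod p)).toAffine.Point} {e : ZMod p}
    {he : (⟨0, 4, 0, 2, 0⟩ : WeierstrassCurve (ZMod p)).toAffine.Nonsingular e 0} (hQ : Q + Q = .some e 0 he) :
    ∃ x y : ZMod p, y ≠ 0 ∧ y ^ 2 = x ^ 3 + 4 * x ^ 2 + 2 * x ∧ e * (2 * y) ^ 2 = (x ^ 2 - 2) ^ 2 := by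
  rcases Q with _ | ⟨x, y, hxy⟩
  · exact absurd hQ (fun h ↦ Affine.Point.some_ne_zero _ (h.symm.trans (add_zero _)))
  · have h2 : (2 : ZMod p) ≠ 0 := Ring.two_ne_zero (by rw [ZMod.ringChar_zmod_n]; exact hp2)
    by_cases hy : y = (⟨0, 4, 0, 2, 0⟩ : WeierstrassCurve (ZMod p)).toAffine.negY x y
    · rw [Affine.Point.add_self_of_Y_eq hy] at hQ
      exact absurd hQ.symm (Affine.Point.some_ne_zero _)
    · have hy0 : y ≠ 0 := by
        intro h0; apply hy; rw [negY_of_isTwoTorsionNF, h0, neg_zero]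
      have hcurve : y ^ 2 = x ^ 3 + 4 * x ^ 2 + 2 * x := by
        have := (equation_iff_of_isTwoTorsionNF _ x y).mp hxy.1; simpa using this
      rw [Affine.Point.add_self_of_Y_ne hy] at hQ
      set ℓ := (⟨0, 4, 0, 2, 0⟩ : WeierstrassCurve (ZMod p)).toAffine.slope x x y y with hℓdef
      have hX : (⟨0, 4, 0, 2, 0⟩ : WeierstrassCurve (ZMod p)).toAffine.addX x x ℓ = e :=
        ((Affine.Point.some.injEq _ _ _ _ _ _).mp hQ).1
      have hX' : e = ℓ ^ 2 - 4 - x - x := by rw [← hX, addX_self_eq]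
      have hneg : (⟨0, 4, 0, 2, 0⟩ : WeierstrassCurve (ZMod p)).toAffine.negY x y = -y := negY_of_isTwoTorsionNF _ x y
      have hℓ : ℓ = (3 * x ^ 2 + 2 * 4 * x + 2 - 0 * y) / (y - -y) := by
        rw [hℓdef, Affine.slope_of_Y_ne rfl hy, hneg]
      have hℓ2 : ℓ * (2 * y) = 3 * x ^ 2 + 8 * x + 2 := by
        rw [hℓ, show y - -y = 2 * y by ring, div_mul_cancel₀ _ (mul_ne_zero h2 hy0)]; ring
      refine ⟨x, y, hy0, hcurve, ?_⟩
      linear_combination (4 * y ^ 2) * hX' + (ℓ * (2 * y) + (3 * x ^ 2 + 8 * x + 2)) * hℓ2 +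
        (-4) * (4 + 2 * x) * hcurve

/-- **At `p ≡ 9 (mod 16)` no `2`-torsion point of `B₁(𝔽_p)` is divisible by `2`**: with `η⁴ = −1`, `s = η + η⁻¹`, the `2`-torsion
points are `(0,0)`, `(−2 ± s, 0)`; halving `(0,0)` makes `2 ± s` a square and halving `(−2 ± s, 0)` makes `−(2 ∓ s)` a square, but
`2 + s`, `2 − s = 2 + η³ + η⁻³` are non-squares (`η`, `η³` are non-squares) and `−1` is a square.
[cite: SilvermanAEC2009, III.2.3] [cite: Rajwade1968, Thm. 1] -/
theorem add_self_ne_twoTorsion (hp : p % 16 = 9) (Q : (⟨0, 4, 0, 2, 0⟩ : WeierstrassCurve (ZMod p)).toAffine.Point)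
    {e : ZMod p} (he : (⟨0, 4, 0, 2, 0⟩ : WeierstrassCurve (ZMod p)).toAffine.Nonsingular e 0)
    (he0 : e * (e ^ 2 + 4 * e + 2) = 0) : Q + Q ≠ .some e 0 he := by
  intro hQ
  have hp2 : p ≠ 2 := by rintro rfl; norm_num at hp
  have h2 : (2 : ZMod p) ≠ 0 := Ring.two_ne_zero (by rw [ZMod.ringChar_zmod_n]; exact hp2)
  obtain ⟨η, hη⟩ := exists_pow_four_eq_neg_one (p := p) (by omega)
  have hη0 : η ≠ 0 := by rintro rfl; norm_num at hη
  set s := η + η⁻¹ with hs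
  have hs2 : s ^ 2 = 2 := sq_eta_add_inv hη
  -- `η³` also satisfies `(η³)⁴ = −1` and `η³ + η⁻³ = −s`
  have hη3 : (η ^ 3) ^ 4 = -1 := by rw [← pow_mul, show 3 * 4 = 4 * 3 by norm_num, pow_mul, hη]; norm_num
  have hs3 : η ^ 3 + (η ^ 3)⁻¹ = -s := by
    rw [hs]
    have h8 : η ^ 4 + 1 = 0 := by rw [hη]; ring
    field_simp
    linear_combination (η ^ 2 + 1) * h8
  have hns_plus : ¬ IsSquare (2 + s) := fun h ↦
    not_isSquare_of_pow_four_eq_neg_one hp hη ((isSquare_two_add_iff h2 hη).mp h)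
  have hns_minus : ¬ IsSquare (2 - s) := fun h ↦
    not_isSquare_of_pow_four_eq_neg_one hp hη3 ((isSquare_two_add_iff h2 hη3).mp (by rw [hs3, ← sub_eq_add_neg]; exact h))
  have hm1 : IsSquare (-1 : ZMod p) := ZMod.exists_sq_eq_neg_one_iff.mpr (by omega)
  obtain ⟨x, y, hy0, hcurve, hkey⟩ := isSquare_of_add_self_eq hp2 hQ
  -- the three `2`-torsion abscissae: `e = 0` or `e = −2 ± s`
  have hroots : e = 0 ∨ e = -2 + s ∨ e = -2 - s := by
    rcases mul_eq_zero.mp he0 with h | h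
    · exact Or.inl h
    · right
      have : (e - (-2 + s)) * (e - (-2 - s)) = 0 := by
        have : (e - (-2 + s)) * (e - (-2 - s)) = e ^ 2 + 4 * e + 4 - s ^ 2 := by ring
        rw [this, hs2]; linear_combination h
      rcases mul_eq_zero.mp this with h1 | h1
      · exact Or.inl (by linear_combination h1)
      · exact Or.inr (by linear_combination h1)
  have hsqe : IsSquare e ∨ e = 0 := by
    by_cases he' : e = 0
    · exact Or.inr he'
    · left
      refine ⟨(x ^ 2 - 2) / (2 * y), ?_⟩
      field_simp
      linear_combination hkey
  rcases hroots with rfl | rfl | rfl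
  · -- halving `(0,0)`: `x² = 2`, `(y/2)² = 2 + x`, `x = ±s`
    rw [zero_mul, eq_comm] at hkey
    have hx2 : x ^ 2 = 2 := by
      have := pow_eq_zero_iff (n := 2) (by norm_num) |>.mp hkey
      linear_combination this
    have hxs : x = s ∨ x = -s := by
      have : (x - s) * (x + s) = 0 := by linear_combination hx2 - hs2
      rcases mul_eq_zero.mp this with h | h
      · exact Or.inl (by linear_combination h)
      · exact Or.inr (by linear_combination h)
    have hsq : IsSquare (2 + x) := by
      refine ⟨y / 2, ?_⟩
      field_simp
      have : x ^ 3 = 2 * x := by linear_combination x * hx2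
      linear_combination -hcurve - this - 4 * hx2
    rcases hxs with rfl | rfl
    · exact hns_plus hsq
    · exact hns_minus (by rw [sub_eq_add_neg]; exact hsq)
  · -- halving `(−2+s, 0)`: `−2 + s = −(2 − s)` is a square
    rcases hsqe with h | h
    · apply hns_minus
      have : 2 - s = -1 * (-2 + s) := by ring
      rw [this]; exact hm1.mul h
    · apply h2
      have : s = 2 := by linear_combination h
      rw [this] at hs2
      linear_combination hs2
  · rcases hsqe with h | h
    · apply hns_plus
      have : 2 + s = -1 * (-2 - s) := by ring
      rw [this]; exact hm1.mul h
    · apply h2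
      have : s = -2 := by linear_combination -h
      rw [this] at hs2
      linear_combination hs2

end Doubling

/-! ### §3 `p ≡ 9 (mod 16)`: `8 ∤ #B₁(𝔽_p)` -/

section NotEight

variable {p : ℕ} [Fact p.Prime]

/-- `B₁(𝔽_p)` is finite. [cite: SilvermanAEC2009, V.1] -/
theorem finite_point_B (hp2 : p ≠ 2) : Finite (⟨0, 4, 0, 2, 0⟩ : WeierstrassCurve (ZMod p)).toAffine.Point := by
  have h2 : (2 : ZMod p) ≠ 0 := Ring.two_ne_zero (by rw [ZMod.ringChar_zmod_n]; exact hp2)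
  haveI hE : (⟨0, 4, 0, 2, 0⟩ : WeierstrassCurve (ZMod p)).IsElliptic := by have := isElliptic_B (n := (1 : ZMod p)) one_ne_zero h2; simpa using this
  exact Nat.finite_of_card_ne_zero (by rw [WeierstrassCurve.natCard_point_eq_one_add_card _ hE.isUnit.ne_zero]; omega)

/-- For `p ≡ 1 (mod 8)` the `2`-torsion of `B₁(𝔽_p)` lies in `{O, (0,0), (−2+s,0), (−2−s,0)}` (`s² = 2`): at most four points `P` with
`P + P = O`. [cite: SilvermanAEC2009, III.2.3] -/
theorem natCard_ker_double_le_four (hp : p % 8 = 1) (f : (⟨0, 4, 0, 2, 0⟩ : WeierstrassCurve (ZMod p)).toAffine.Point →+ (⟨0, 4, 0, 2, 0⟩ : WeierstrassCurve (ZMod p)).toAffine.Point)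
    (hf : ∀ P, f P = P + P) : Nat.card f.ker ≤ 4 := by
  have hp2 : p ≠ 2 := by rintro rfl; norm_num at hp
  have h2 : (2 : ZMod p) ≠ 0 := Ring.two_ne_zero (by rw [ZMod.ringChar_zmod_n]; exact hp2)
  obtain ⟨η, hη⟩ := exists_pow_four_eq_neg_one (p := p) hp
  set s := η + η⁻¹ with hs
  have hs2 : s ^ 2 = 2 := sq_eta_add_inv hη
  haveI hE : (⟨0, 4, 0, 2, 0⟩ : WeierstrassCurve (ZMod p)).IsElliptic := by have := isElliptic_B (n := (1 : ZMod p)) one_ne_zero h2; simpa using this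
  haveI : Finite (⟨0, 4, 0, 2, 0⟩ : WeierstrassCurve (ZMod p)).toAffine.Point := finite_point_B hp2
  have hns : ∀ x : ZMod p, x * (x ^ 2 + 4 * x + 2) = 0 → (⟨0, 4, 0, 2, 0⟩ : WeierstrassCurve (ZMod p)).toAffine.Nonsingular x 0 := by
    intro x hx
    refine (Affine.equation_iff_nonsingular).mp ((equation_iff_of_isTwoTorsionNF _ x 0).mpr ?_)
    linear_combination -hx
  have h0 : (0 : ZMod p) * (0 ^ 2 + 4 * 0 + 2) = 0 := by ring
  have h1 : (-2 + s) * ((-2 + s) ^ 2 + 4 * (-2 + s) + 2) = 0 := by linear_combination (-2 + s) * hs2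
  have h2' : (-2 - s) * ((-2 - s) ^ 2 + 4 * (-2 - s) + 2) = 0 := by linear_combination (-2 - s) * hs2
  set S : Finset (⟨0, 4, 0, 2, 0⟩ : WeierstrassCurve (ZMod p)).toAffine.Point :=
    {0, .some 0 0 (hns 0 h0), .some (-2 + s) 0 (hns _ h1), .some (-2 - s) 0 (hns _ h2')} with hSdef
  have hsub : (f.ker : Set (⟨0, 4, 0, 2, 0⟩ : WeierstrassCurve (ZMod p)).toAffine.Point) ⊆ ↑S := by
    intro P hP
    rw [SetLike.mem_coe, AddMonoidHom.mem_ker, hf] at hP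
    rcases eq_of_add_self_eq_zero hp2 hP with rfl | ⟨x, hx, rfl, hroot⟩
    · simp [hSdef]
    · have hx3 : x = 0 ∨ x = -2 + s ∨ x = -2 - s := by
        rcases mul_eq_zero.mp hroot with h | h
        · exact Or.inl h
        · right
          have : (x - (-2 + s)) * (x - (-2 - s)) = 0 := by
            have : (x - (-2 + s)) * (x - (-2 - s)) = x ^ 2 + 4 * x + 4 - s ^ 2 := by ring
            rw [this, hs2]; linear_combination h
          rcases mul_eq_zero.mp this with h' | h'
          · exact Or.inl (by linear_combination h')
          · exact Or.inr (by linear_combination h')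
      simp only [hSdef, Finset.coe_insert, Finset.coe_singleton, Set.mem_insert_iff, Set.mem_singleton_iff]
      rcases hx3 with rfl | rfl | rfl
      · exact Or.inr (Or.inl rfl)
      · exact Or.inr (Or.inr (Or.inl rfl))
      · exact Or.inr (Or.inr (Or.inr rfl))
  calc Nat.card f.ker = Nat.card (f.ker : Set (⟨0, 4, 0, 2, 0⟩ : WeierstrassCurve (ZMod p)).toAffine.Point) := rfl
    _ ≤ Nat.card (↑S : Set (⟨0, 4, 0, 2, 0⟩ : WeierstrassCurve (ZMod p)).toAffine.Point) := Nat.card_mono (Set.toFinite _) hsub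
    _ = S.card := by rw [Nat.card_coe_set_eq]; simp
    _ ≤ 4 := by
        rw [hSdef]
        refine (Finset.card_insert_le _ _).trans ?_
        refine (Nat.succ_le_succ (Finset.card_insert_le _ _)).trans ?_
        refine (Nat.succ_le_succ (Nat.succ_le_succ (Finset.card_insert_le _ _))).trans ?_
        rw [Finset.card_singleton]

/-- ★ **`8 ∤ #B₁(𝔽_p)` for `p ≡ 9 (mod 16)`**: the doubling map `P ↦ 2P` has kernel of order `≤ 4` and image of odd order (an element
of order `2` in the image would be a halved `2`-torsion point, excluded by `add_self_ne_twoTorsion`), and `#B₁ = #ker · #image`.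
[cite: Rajwade1968, Thm. 1] [cite: SilvermanAEC2009, III.2.3] -/
theorem not_eight_dvd_natCard (hp : p % 16 = 9) : ¬ 8 ∣ Nat.card (⟨0, 4, 0, 2, 0⟩ : WeierstrassCurve (ZMod p)).toAffine.Point := by
  have hp2 : p ≠ 2 := by rintro rfl; norm_num at hp
  haveI : Finite (⟨0, 4, 0, 2, 0⟩ : WeierstrassCurve (ZMod p)).toAffine.Point := finite_point_B hp2
  intro h8
  set f : (⟨0, 4, 0, 2, 0⟩ : WeierstrassCurve (ZMod p)).toAffine.Point →+ (⟨0, 4, 0, 2, 0⟩ : WeierstrassCurve (ZMod p)).toAffine.Point := AddMonoidHom.mk' (fun P ↦ P + P) (fun a b ↦ by abel) with hfdef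
  have hf : ∀ P, f P = P + P := fun P ↦ rfl
  have hcard : Nat.card (⟨0, 4, 0, 2, 0⟩ : WeierstrassCurve (ZMod p)).toAffine.Point = Nat.card f.range * Nat.card f.ker := by
    rw [AddSubgroup.card_eq_card_quotient_mul_card_addSubgroup f.ker,
      Nat.card_congr (QuotientAddGroup.quotientKerEquivRange f).toEquiv]
  have hker := natCard_ker_double_le_four (p := p) (by omega) f hf
  have hodd : ¬ 2 ∣ Nat.card f.range := by
    intro h2r
    letI : Fintype f.range := Fintype.ofFinite _
    rw [Nat.card_eq_fintype_card] at h2r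
    haveI : Fact (Nat.Prime 2) := ⟨Nat.prime_two⟩
    obtain ⟨R, hR⟩ := exists_prime_addOrderOf_dvd_card 2 h2r
    obtain ⟨hR2, hR0⟩ := (addOrderOf_eq_prime_iff).mp hR
    obtain ⟨Q, hQ⟩ := R.2
    have hRR : (R : (⟨0, 4, 0, 2, 0⟩ : WeierstrassCurve (ZMod p)).toAffine.Point) + R = 0 := by
      have := congrArg Subtype.val hR2
      simpa [two_nsmul] using this
    have hR0' : (R : (⟨0, 4, 0, 2, 0⟩ : WeierstrassCurve (ZMod p)).toAffine.Point) ≠ 0 := fun h ↦ hR0 (Subtype.ext h)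
    rcases eq_of_add_self_eq_zero hp2 hRR with h | ⟨x, hx, hxR, hroot⟩
    · exact hR0' h
    · have hQ' : Q + Q = .some x 0 hx := by rw [← hxR, ← hQ]; rfl
      exact add_self_ne_twoTorsion hp Q hx hroot hQ'
  rw [hcard] at h8
  have hcop : Nat.Coprime 8 (Nat.card f.range) := by
    have : Nat.Coprime 2 (Nat.card f.range) := (Nat.Prime.coprime_iff_not_dvd Nat.prime_two).mpr hodd
    simpa using this.pow_left 3
  have h8k : 8 ∣ Nat.card f.ker := hcop.dvd_of_dvd_mul_left h8
  have hpos : 0 < Nat.card f.ker := Nat.card_pos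
  have := Nat.le_of_dvd hpos h8k
  omega

end NotEight

/-! ### §4 `p ≡ 1 (mod 16)`: `8 ∣ #B₁(𝔽_p)` -/

section Eight

variable {p : ℕ} [Fact p.Prime]

/-- ★ **`8 ∣ #B₁(𝔽_p)` for `p ≡ 1 (mod 16)`**: with `ζ⁸ = −1`, `η = ζ²`, `s = η + η⁻¹`, `w = ζ + ζ⁻¹` (`s² = 2`, `w² = 2 + s`) the point
`P = (s, 2w)` satisfies `2P = (0,0)`, so has order `4`, and `(−2+s, 0) ∉ ⟨P⟩`; Lagrange in `B₁(𝔽_p)/⟨P⟩`.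
[cite: Rajwade1968, Thm. 1] [cite: SilvermanAEC2009, III.2.3] -/
theorem eight_dvd_natCard (hp : p % 16 = 1) : 8 ∣ Nat.card (⟨0, 4, 0, 2, 0⟩ : WeierstrassCurve (ZMod p)).toAffine.Point := by
  have hp2 : p ≠ 2 := by rintro rfl; norm_num at hp
  have h2 : (2 : ZMod p) ≠ 0 := Ring.two_ne_zero (by rw [ZMod.ringChar_zmod_n]; exact hp2)
  have h4 : (4 : ZMod p) ≠ 0 := by rw [show (4 : ZMod p) = 2 * 2 by norm_num]; exact mul_ne_zero h2 h2
  obtain ⟨ζ, hζ⟩ := exists_pow_eight_eq_neg_one (p := p) hp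
  have hζ0 : ζ ≠ 0 := by rintro rfl; norm_num at hζ
  have hζ1 : ζ * ζ⁻¹ = 1 := mul_inv_cancel₀ hζ0
  set η := ζ ^ 2 with hηdef
  have hη : η ^ 4 = -1 := by rw [hηdef, ← pow_mul]; exact hζ
  set s := η + η⁻¹ with hs
  have hs2 : s ^ 2 = 2 := sq_eta_add_inv hη
  set w := ζ + ζ⁻¹ with hwdef
  have hw2 : w ^ 2 = 2 + s := by
    calc w ^ 2 = ζ ^ 2 + 2 * (ζ * ζ⁻¹) + (ζ⁻¹) ^ 2 := by rw [hwdef]; ring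
      _ = 2 + s := by rw [hζ1, hs, hηdef, inv_pow]; ring
  have hw0 : w ≠ 0 := by
    intro h
    rw [h] at hw2
    have : s = -2 := by linear_combination -hw2
    rw [this] at hs2
    exact h2 (by linear_combination hs2)
  haveI hE : (⟨0, 4, 0, 2, 0⟩ : WeierstrassCurve (ZMod p)).IsElliptic := by have := isElliptic_B (n := (1 : ZMod p)) one_ne_zero h2; simpa using this
  have hns : ∀ x y : ZMod p, y ^ 2 = x ^ 3 + 4 * x ^ 2 + 2 * x → (⟨0, 4, 0, 2, 0⟩ : WeierstrassCurve (ZMod p)).toAffine.Nonsingular x y := by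
    intro x y hxy
    exact (Affine.equation_iff_nonsingular).mp ((equation_iff_of_isTwoTorsionNF _ x y).mpr hxy)
  have hPeq : (2 * w) ^ 2 = s ^ 3 + 4 * s ^ 2 + 2 * s := by
    have : s ^ 3 = 2 * s := by linear_combination s * hs2
    rw [this]; linear_combination 4 * hw2 - 4 * hs2
  have hT0eq : (0 : ZMod p) ^ 2 = 0 ^ 3 + 4 * 0 ^ 2 + 2 * 0 := by ring
  have hT1eq : (0 : ZMod p) ^ 2 = (-2 + s) ^ 3 + 4 * (-2 + s) ^ 2 + 2 * (-2 + s) := by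
    linear_combination (2 - s) * hs2
  set P : (⟨0, 4, 0, 2, 0⟩ : WeierstrassCurve (ZMod p)).toAffine.Point := .some s (2 * w) (hns _ _ hPeq) with hPdef
  set T0 : (⟨0, 4, 0, 2, 0⟩ : WeierstrassCurve (ZMod p)).toAffine.Point := .some 0 0 (hns _ _ hT0eq) with hT0def
  set T1 : (⟨0, 4, 0, 2, 0⟩ : WeierstrassCurve (ZMod p)).toAffine.Point := .some (-2 + s) 0 (hns _ _ hT1eq) with hT1def
  -- `P + P = T0`
  have hneg : (⟨0, 4, 0, 2, 0⟩ : WeierstrassCurve (ZMod p)).toAffine.negY s (2 * w) = -(2 * w) := negY_of_isTwoTorsionNF _ _ _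
  have hyne : 2 * w ≠ (⟨0, 4, 0, 2, 0⟩ : WeierstrassCurve (ZMod p)).toAffine.negY s (2 * w) := by
    rw [hneg]
    intro h
    have : (2 : ZMod p) * (2 * w) = 0 := by linear_combination h
    exact mul_ne_zero h2 (mul_ne_zero h2 hw0) this
  have hPP : P + P = T0 := by
    rw [hPdef, Affine.Point.add_self_of_Y_ne hyne]
    set ℓ := (⟨0, 4, 0, 2, 0⟩ : WeierstrassCurve (ZMod p)).toAffine.slope s s (2 * w) (2 * w) with hℓdef
    have hℓ : ℓ = (3 * s ^ 2 + 2 * 4 * s + 2 - 0 * (2 * w)) / (2 * w - -(2 * w)) := by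
      rw [hℓdef, Affine.slope_of_Y_ne rfl hyne, hneg]
    have hℓ4 : ℓ * (4 * w) = 3 * s ^ 2 + 8 * s + 2 := by
      rw [hℓ, show (2 : ZMod p) * w - -(2 * w) = 4 * w by ring, div_mul_cancel₀ _ (mul_ne_zero h4 hw0)]; ring
    have hℓw : ℓ * w = 2 * (1 + s) := by
      apply mul_left_cancel₀ h4
      linear_combination hℓ4 + 3 * hs2
    have hℓsq : ℓ ^ 2 = 4 + 2 * s := by
      have h2s : (2 : ZMod p) + s ≠ 0 := by rw [← hw2]; exact pow_ne_zero _ hw0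
      have hsq : (ℓ * w) ^ 2 = (2 * (1 + s)) ^ 2 := by rw [hℓw]
      have hℓ2 : ℓ ^ 2 * (2 + s) = 12 + 8 * s := by linear_combination hsq - ℓ ^ 2 * hw2 + 4 * hs2
      apply mul_right_cancel₀ h2s
      linear_combination hℓ2 - 2 * hs2
    have hX : (⟨0, 4, 0, 2, 0⟩ : WeierstrassCurve (ZMod p)).toAffine.addX s s ℓ = 0 := by
      rw [addX_self_eq, hℓsq]; simp only; ring
    have hℓs : ℓ * s = 2 * w := by
      apply mul_right_cancel₀ hw0
      linear_combination s * hℓw + 2 * hs2 - 2 * hw2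
    have hY : (⟨0, 4, 0, 2, 0⟩ : WeierstrassCurve (ZMod p)).toAffine.addY s s (2 * w) ℓ = 0 := by
      rw [addY_self_eq, hX]; linear_combination hℓs
    obtain ⟨h', e'⟩ := some_eq_some_of_eq _ hX hY
    rw [e']
  -- order of `P` is `4`
  have hP0 : P ≠ 0 := Affine.Point.some_ne_zero _
  have hT00 : T0 ≠ 0 := Affine.Point.some_ne_zero _
  have h2P : 2 • P ≠ 0 := by rw [two_nsmul, hPP]; exact hT00
  have hT0T0 : T0 + T0 = 0 := Affine.Point.add_self_of_Y_eq (by rw [negY_of_isTwoTorsionNF, neg_zero])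
  have h4P : 4 • P = 0 := by
    calc 4 • P = 2 • P + 2 • P := by rw [show (4 : ℕ) = 2 + 2 from rfl, add_nsmul]
      _ = 0 := by rw [two_nsmul, hPP, hT0T0]
  have hord : addOrderOf P = 4 := by
    have hdvd : addOrderOf P ∣ 2 ^ 2 := addOrderOf_dvd_of_nsmul_eq_zero h4P
    obtain ⟨k, hk, hk'⟩ := (Nat.dvd_prime_pow Nat.prime_two).mp hdvd
    interval_cases k
    · exfalso; rw [pow_zero, AddMonoid.addOrderOf_eq_one_iff] at hk'; exact hP0 hk'
    · exfalso; apply h2P; have h := addOrderOf_nsmul_eq_zero P; rw [hk', pow_one] at h; exact h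
    · exact hk'
  set H := AddSubgroup.zmultiples P with hHdef
  have hHcard : Nat.card H = 4 := by rw [hHdef, Nat.card_zmultiples, hord]
  -- `T1 ∉ H`
  have hs0 : s ≠ 0 := by intro h; rw [h] at hs2; exact h2 (by linear_combination -hs2)
  have he1s : (-2 : ZMod p) + s ≠ s := by intro h; exact h2 (by linear_combination -h)
  have he10 : (-2 : ZMod p) + s ≠ 0 := by
    intro h
    have : s = 2 := by linear_combination h
    rw [this] at hs2; exact h2 (by linear_combination hs2)
  have hT1 : T1 ∉ H := by
    rw [hHdef, AddSubgroup.mem_zmultiples_iff]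
    rintro ⟨k, hk⟩
    have h4z : (4 : ℤ) • P = 0 := by exact_mod_cast h4P
    have hred : k • P = (k % 4) • P := by
      have hk4 : k = k / 4 * 4 + k % 4 := by omega
      conv_lhs => rw [hk4]
      rw [add_zsmul, mul_zsmul, h4z, zsmul_zero, zero_add]
    rw [hred] at hk
    have hr : k % 4 = 0 ∨ k % 4 = 1 ∨ k % 4 = 2 ∨ k % 4 = 3 := by omega
    rcases hr with h | h | h | h <;> rw [h] at hk
    · rw [zero_zsmul] at hk; exact Affine.Point.some_ne_zero _ hk.symm
    · rw [one_zsmul, hPdef, hT1def] at hk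
      exact he1s ((Affine.Point.some.injEq _ _ _ _ _ _).mp hk).1.symm
    · rw [show (2 : ℤ) • P = (2 : ℕ) • P from by norm_cast, two_nsmul, hPP, hT0def, hT1def] at hk
      exact he10 ((Affine.Point.some.injEq _ _ _ _ _ _).mp hk).1.symm
    · have h3 : (3 : ℤ) • P = -P := by
        rw [eq_neg_iff_add_eq_zero, ← add_one_zsmul]; exact h4z
      rw [h3, hPdef, Affine.Point.neg_some, hT1def] at hk
      exact he1s ((Affine.Point.some.injEq _ _ _ _ _ _).mp hk).1.symm
  -- Lagrange in the quotient
  have hq : Nat.card (⟨0, 4, 0, 2, 0⟩ : WeierstrassCurve (ZMod p)).toAffine.Point = Nat.card ((⟨0, 4, 0, 2, 0⟩ : WeierstrassCurve (ZMod p)).toAffine.Point ⧸ H) * Nat.card H :=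
    AddSubgroup.card_eq_card_quotient_mul_card_addSubgroup H
  have hT1q : addOrderOf (QuotientAddGroup.mk T1 : (⟨0, 4, 0, 2, 0⟩ : WeierstrassCurve (ZMod p)).toAffine.Point ⧸ H) = 2 := by
    haveI : Fact (Nat.Prime 2) := ⟨Nat.prime_two⟩
    refine addOrderOf_eq_prime_iff.mpr ⟨?_, ?_⟩
    · rw [← QuotientAddGroup.mk_nsmul, two_nsmul, hT1def,
        Affine.Point.add_self_of_Y_eq (by rw [negY_of_isTwoTorsionNF, neg_zero]), QuotientAddGroup.mk_zero]
    · intro h; exact hT1 ((QuotientAddGroup.eq_zero_iff T1).mp h)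
  have h2q : 2 ∣ Nat.card ((⟨0, 4, 0, 2, 0⟩ : WeierstrassCurve (ZMod p)).toAffine.Point ⧸ H) := by
    have h := addOrderOf_dvd_natCard (QuotientAddGroup.mk T1 : (⟨0, 4, 0, 2, 0⟩ : WeierstrassCurve (ZMod p)).toAffine.Point ⧸ H)
    rwa [hT1q] at h
  rw [hq, hHcard]
  obtain ⟨m, hm⟩ := h2q
  exact ⟨m, by rw [hm]; ring⟩

end Eight

/-! ### §5 Brewer's theorem for `p ≡ 1 (mod 8)` -/

section Assembly

/-- **Uniqueness of `p = a² + 2b²` up to signs** (for `p` prime): if also `p = c² + 2d²` then `c = ±a`.  Brahmagupta: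
`p² = (ac ± 2bd)² + 2(ad ∓ bc)²`, so `|ad ∓ bc| < p`, while `p ∣ (ad − bc)(ad + bc) = p(d² − b²)`.
[cite: IrelandRosen1990, Ch. 1 Ex. 36 (unique factorisation in ℤ[√-2])] -/
theorem eq_or_eq_neg_of_sq_add_two_sq {p : ℕ} (hp : p.Prime) {a b c d : ℤ} (hab : (p : ℤ) = a ^ 2 + 2 * b ^ 2)
    (hcd : (p : ℤ) = c ^ 2 + 2 * d ^ 2) : c = a ∨ c = -a := by
  have hprime : Prime (p : ℤ) := Nat.prime_iff_prime_int.mp hp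
  have hp0 : (0 : ℤ) < p := by exact_mod_cast hp.pos
  have hkey : (a * d - b * c) * (a * d + b * c) = (p : ℤ) * (d ^ 2 - b ^ 2) := by
    linear_combination (-d ^ 2) * hab + b ^ 2 * hcd
  have hB1 : (p : ℤ) ^ 2 = (a * c + 2 * b * d) ^ 2 + 2 * (a * d - b * c) ^ 2 := by
    rw [sq]; nth_rw 1 [hab]; rw [hcd]; ring
  have hB2 : (p : ℤ) ^ 2 = (a * c - 2 * b * d) ^ 2 + 2 * (a * d + b * c) ^ 2 := by
    rw [sq]; nth_rw 1 [hab]; rw [hcd]; ring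
  have hlt1 : (a * d - b * c) ^ 2 < (p : ℤ) ^ 2 := by nlinarith [sq_nonneg (a * c + 2 * b * d), sq_nonneg (a * d - b * c)]
  have hlt2 : (a * d + b * c) ^ 2 < (p : ℤ) ^ 2 := by nlinarith [sq_nonneg (a * c - 2 * b * d), sq_nonneg (a * d + b * c)]
  have hzero : ∀ x : ℤ, (p : ℤ) ∣ x → x ^ 2 < (p : ℤ) ^ 2 → x = 0 := by
    rintro x ⟨k, rfl⟩ hx
    have : k ^ 2 < 1 := by
      by_contra h
      push Not at h
      nlinarith [sq_nonneg k]
    have hk : k = 0 := by nlinarith [sq_nonneg k]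
    rw [hk, mul_zero]
  have hsq : a ^ 2 * d ^ 2 = b ^ 2 * c ^ 2 := by
    rcases hprime.dvd_or_dvd ⟨_, hkey⟩ with h | h
    · have h0 := hzero _ h hlt1
      linear_combination (a * d + b * c) * h0
    · have h0 := hzero _ h hlt2
      linear_combination (a * d - b * c) * h0
  have hc2 : c ^ 2 = a ^ 2 := by
    have : (p : ℤ) * c ^ 2 = (p : ℤ) * a ^ 2 := by
      linear_combination c ^ 2 * hab - a ^ 2 * hcd - 2 * hsq
    exact mul_left_cancel₀ hp0.ne' this
  exact sq_eq_sq_iff_eq_or_eq_neg.mp hc2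

variable {p : ℕ} [Fact p.Prime]

/-- **`a_p(B₁) mod 8` for `p ≡ 1 (mod 8)`**: with `a_p(B₁) = 2a`, `p = a² + 2b²` (Deuring, unsigned): `a ≡ 1 (mod 4)` if `p ≡ 1 (mod 16)`
and `a ≡ 3 (mod 4)` if `p ≡ 9 (mod 16)` — from `#B₁(𝔽_p) ≡ 0` resp. `4 (mod 8)` (§§3–4). [cite: Rajwade1968, Thm. 1] [cite: LeonardWilliams1975, Theorem (p. 301)] -/
theorem frobeniusTrace_half_mod_four (hp8 : p % 8 = 1) {a b : ℤ} (hab : (p : ℤ) = a ^ 2 + 2 * b ^ 2)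
    (htr : Literature.NumberTheory.Automorphic.frobeniusTrace (⟨0, 4, 0, 2, 0⟩ : WeierstrassCurve ℤ) p = 2 * a) :
    a % 4 = (if (p / 8) % 2 = 0 then 1 else 3) := by
  have hp : p.Prime := Fact.out
  have h1 : (⟨0, 4, 0, 2, 0⟩ : WeierstrassCurve ℤ).map (Int.castRingHom (ZMod p)) = (⟨0, 4, 0, 2, 0⟩ : WeierstrassCurve (ZMod p)) := by
    simp [WeierstrassCurve.map]
  unfold Literature.NumberTheory.Automorphic.frobeniusTrace Literature.NumberTheory.Automorphic.numPointsMod at htr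
  rw [h1] at htr
  set N := Nat.card (⟨0, 4, 0, 2, 0⟩ : WeierstrassCurve (ZMod p)).toAffine.Point with hN
  have haodd : a % 2 = 1 := by
    rcases Int.emod_two_eq_zero_or_one a with h | h
    · exfalso
      obtain ⟨k, hk⟩ : ∃ k, a = 2 * k := ⟨a / 2, by omega⟩
      have h2 : (p : ℤ) = 2 * (2 * k ^ 2 + b ^ 2) := by rw [hab, hk]; ring
      omega
    · exact h
  have hNint : (N : ℤ) = p + 1 - 2 * a := by linarith
  by_cases h16 : p % 16 = 1
  · have h8 : 8 ∣ N := eight_dvd_natCard h16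
    obtain ⟨m, hm⟩ := h8
    have : (p / 8) % 2 = 0 := by omega
    rw [if_pos this]
    omega
  · have h16' : p % 16 = 9 := by omega
    have h8 : ¬ 8 ∣ N := not_eight_dvd_natCard h16'
    have : (p / 8) % 2 = 1 := by omega
    rw [if_neg (by omega)]
    have hN8 : ¬ (8 : ℤ) ∣ (N : ℤ) := fun h ↦ h8 (by exact_mod_cast h)
    omega

/-- ★ **Brewer's theorem for `p ≡ 1 (mod 8)`** (Brewer 1961; Leonard–Williams 1975, Theorem p. 301, the case `p = 8k + 1`): for a prime
`p ≡ 1 (mod 8)`, `p = c² + 2d²` with `c ≡ (−1)^{k+1} (mod 4)`, `k = ⌊p/8⌋`: `Σ_{x} ((x + 2)(x² − 2)/p) = 2c`.  PROVED here without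
cyclotomy: Deuring (unsigned, `SqrtTwoTwistFrobeniusNorm`) + the `2`-Sylow subgroup of `B₁(𝔽_p)` (§§3–4) + uniqueness of `p = a² + 2b²`.
[cite: LeonardWilliams1975, Theorem (p. 301)] [cite: Brewer1961, Theorem 2] -/
theorem brewer_characterSum_of_mod_eight_eq_one (hp8 : p % 8 = 1) {c d : ℤ} (hcd : (p : ℤ) = c ^ 2 + 2 * d ^ 2)
    (hc4 : c % 4 = (if (p / 8) % 2 = 0 then 3 else 1)) : brewerSum (ZMod p) = 2 * c := by
  have hp : p.Prime := Fact.out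
  have hp2 : p ≠ 2 := by rintro rfl; norm_num at hp8
  have hchar : ringChar (ZMod p) ≠ 2 := by rw [ZMod.ringChar_zmod_n]; exact hp2
  obtain ⟨a, b, hab, htr⟩ := exists_sq_add_two_sq_and_frobeniusTrace_eq hp (Or.inl hp8)
  have ha4 := frobeniusTrace_half_mod_four hp8 hab htr
  -- `c = -a`
  have hca : c = -a := by
    rcases eq_or_eq_neg_of_sq_add_two_sq hp hab hcd with rfl | h
    · exfalso; split_ifs at hc4 ha4 <;> omega
    · exact h
  -- `B = χ(−1) · Σ χ(x³+4x²+2x) = -a_p` with `χ(−1) = 1`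
  have h1 : (⟨0, 4, 0, 2, 0⟩ : WeierstrassCurve ℤ).map (Int.castRingHom (ZMod p)) = (⟨0, 4, 0, 2, 0⟩ : WeierstrassCurve (ZMod p)) := by
    simp [WeierstrassCurve.map]
  have h2 : (2 : ZMod p) ≠ 0 := Ring.two_ne_zero hchar
  haveI hE : (⟨0, 4, 0, 2, 0⟩ : WeierstrassCurve (ZMod p)).IsElliptic := by have := isElliptic_B (n := (1 : ZMod p)) one_ne_zero h2; simpa using this
  unfold Literature.NumberTheory.Automorphic.frobeniusTrace Literature.NumberTheory.Automorphic.numPointsMod at htr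
  rw [h1, natCard_point_eq_card_add_one_add_sum hchar _ _ hE.isUnit.ne_zero, ZMod.card] at htr
  have hsum : ∑ x : ZMod p, quadraticChar (ZMod p) (x ^ 3 + 4 * x ^ 2 + 2 * x) = -(2 * a) := by linarith
  have hchi : quadraticChar (ZMod p) (-1) = 1 := by
    rw [quadraticChar_neg_one hchar, ZMod.card p]; exact ZMod.χ₄_nat_one_mod_four (by omega)
  have h := sum_quadraticChar_B_eq_brewerSum (F := ZMod p)
  rw [hsum, hchi, one_mul] at h
  rw [← h, hca]; ring

end Assembly

end SqrtTwoTwist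

end Literature.NumberTheory.EllipticCurves

end
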